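import Literature.AlgebraicGeometry.HodgeTheory.WeilClassesRationalPlane
import Literature.AlgebraicGeometry.HodgeTheory.WeilClassesMoonenZarhinCriterion
import Mathlib.LinearAlgebra.Semisimple
import Mathlib.LinearAlgebra.Eigenspace.Semisimple
import Mathlib.LinearAlgebra.Eigenspace.Minpoly
import Mathlib.FieldTheory.IsAlgClosed.Basic
import Mathlib.FieldTheory.Perfect
import Mathlib.RingTheory.AdjoinRoot
import HarnessLib

/-!
# `W_F ⊗ ℂ` is a RATIONAL subspace: `weilClassesField` is spanned by rational classes (Moonen–Zarhin §1)

Layer `Literature/AlgebraicGeometry/HodgeTheory`, theorem-only companion of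
`WeilClassesMoonenZarhinCriterion` (`weilClassesField A φ P r = ⨆_{P(ρ)=0} ⋀ʳ V_{ℂ,ρ} ⊆ Hʳ(A(ℂ); ℂ)`,
the complexified space of Weil classes of a complex abelian variety `A` relative to the field
`F = ℚ(φ) ≅ ℚ[T]/(P)`) and of `WeilClassesRationalPlane` (the quadratic case, van Geemen 4.9:
`weilClassesOf_eq_span_isRationalClass`). Moonen–Zarhin, *Weil classes on abelian varieties*,
J. reine angew. Math. 496 (1998) = arXiv:alg-geom/9612017, §1, verbatim: "Let `W_F := ⋀^r_F V_X`
[`V_X = H¹(X, ℚ)`, `r = 2g/[F:ℚ]`] … Lemma (1): `W_F ⊂ H^r(X, ℚ)` … `W_F ⊗ ℂ = (⋀^r_F V_X) ⊗ ℂ =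
⋀^r_{F ⊗ ℂ} V_ℂ = ⊕_{σ ∈ Σ_F} ⋀^r_ℂ V_{ℂ,σ}`" — so IN PRINT the complex space `⊕_σ ⋀ʳ V_{ℂ,σ}` is, by
definition, the complexification of a `ℚ`-subspace of `Hʳ(X, ℚ)`. On the tree's carriers the space
`W_F ⊗ ℂ` is DEFINED spectrally (`weilClassesField`: joint eigenclasses of the rational operators
`(x·𝟙 + y·φ)^*` for the characters `(x + yρ)ʳ`, `P(ρ) = 0`), and the statement "it is the complex
span of its RATIONAL classes" becomes a theorem to prove — the Galois descent implicit in the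
displayed formula. THIS file proves it, with no hypothesis beyond Moonen–Zarhin's (`F` a field,
`φ ∈ F`):

* `weilClassesField_eq_span_isRationalClass` — for a complex abelian variety `A`, `φ : A ⟶ A` and
  `P ∈ ℤ[T]` IRREDUCIBLE over `ℚ` with `P(φ) = 0` in `End A`, and every `r`:
  **`weilClassesField A φ P r = span_ℂ {c ∈ weilClassesField A φ P r | c rational}`**;
  `weilClassesField_le_span_isRationalClass` (the non-trivial inclusion alone, in the binder shape
  `{c | c ∈ W ∧ IsRationalClass c}` used Summit-side).

## Proof (the operator method of `WeilClassesRationalPlane`, for `e = deg P` eigenvalues)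

Write `F = φ^*|H¹`. (1) `P(F) = 0` on `H¹(A(ℂ); ℂ)` (`hom_complexBetti_map_eval₂_one`: endomorphisms
act on `H¹` additively, `complexBetti_map_add_one`, and contravariantly). (2) `P` is separable, so
`F` is semisimple (Mathlib `Module.End.isSemisimple_of_squarefree_aeval_eq_zero`) and
`H¹ = ⊕_{P(ρ)=0} V_ρ`, `V_ρ = ker(F - ρ)` (`iSup_eigenspace_eq_top`); choose an eigenbasis `b`,
`F bᵢ = λᵢ bᵢ`, `P(λᵢ) = 0`. (3) `Hʳ = ⋀ʳ H¹` (`Motives.AbelianVariety.hasExteriorCohomologyH1_complexPoints`);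
the wedge basis `b_S = ⌣_{i∈S} bᵢ` diagonalises every `(x·𝟙 + y·φ)^*` with character
`∏_{i∈S} (x + yλᵢ)`, and `⋀ʳ V_ρ := pullbackEigenclasses A φ r ((x + yρ)ʳ) = span {b_S : λᵢ = ρ ∀ i ∈ S}`
(`∏_{i∈S}(X + λᵢ) = (X + ρ)ʳ` in `ℂ[X]` forces `λᵢ = ρ`). (4) Choose `x₀ ∈ ℕ` SEPARATING: for every
`S` and every root `ρ`, `∏_{i∈S}(x₀ + λᵢ) = (x₀ + ρ)ʳ` only if all `λᵢ = ρ` (finitely many non-zero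
polynomial differences have finitely many natural roots). (5) Let `K = ℚ[T]/(P)` (a field),
`g = (x₀ + T)ʳ ∈ K`, `M = minpoly_ℚ(g) ∈ ℚ[X]`: the complex roots of `M` are EXACTLY the
`(x₀ + ρ)ʳ`, `P(ρ) = 0` (Mathlib `Algebra.IsAlgebraic.range_eval_eq_rootSet_minpoly`: the roots of a
minimal polynomial are the images under the embeddings `K → ℂ`, `T ↦ ρ`). (6) The operator
`M(T₀)`, `T₀ = (x₀·𝟙 + φ)^*|Hʳ`, has rational coefficients in a pull-back, so it maps rational classes
to rational classes, and its kernel is `span {b_S : M(∏(x₀ + λᵢ)) = 0} = span {b_S : S ⊆ λ⁻¹(ρ), some ρ}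
= W_F ⊗ ℂ` by (4)–(5). (7) The kernel of a rational-class-preserving operator on `Hᵏ(X(ℂ); ℂ)`, `X`
smooth projective, is spanned by its rational classes (`ker_eq_span_isRationalClass`, file
`WeilClassesRationalPlane`). ∎

Everything is proved; no definition, no named fact (D-0026). Consumed Summit-side as the discharge
of the descent binder of the ring-2 row T6-CM (`Ring2TransportWeilTypeGeneralCMFieldSU`), at every
use site of which `P` is irreducible with `P(φ) = 0` (`Deligne1982.IsWeilTypeCM`, rung R3).

## References

* [MoonenZarhin1998WeilClasses] B. J. J. Moonen, Yu. G. Zarhin, *Weil classes on abelian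
  varieties*, J. reine angew. Math. 496 (1998) 83–92 = arXiv:alg-geom/9612017, §1: definition of
  `W_F`, Lemma (1) "`W_F ⊂ H^r(X, ℚ)`", the display `W_F ⊗ ℂ = ⊕_σ ⋀^r_ℂ V_{ℂ,σ}` (arXiv p. 1).
* [Deligne1982HodgeCycles] P. Deligne (notes by J. S. Milne), *Hodge cycles on abelian varieties*,
  LNM 900 (1982), §4 (4.4): "`⋀^d_E H¹(A, ℚ) ↪ H^d(A, ℚ)` … its elements are the Weil classes".
* [vanGeemen1994HodgeAV] B. van Geemen, LNM 1594 (1994), 4.9 (the quadratic case, PDF p. 218).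
* [HatcherAT2002] A. Hatcher, *Algebraic Topology* (2002), §3.1 Thm. 3.2 and p. 198.
-/

noncomputable section

open CategoryTheory Polynomial

universe u

namespace Literature.AlgebraicGeometry.HodgeTheory

section HodgeTheory

open Literature.AlgebraicTopology.SingularHomology
open Literature.AlgebraicGeometry.Motives (IsSmoothProjective)

/-! ### Arithmetic: `∏ (X + λᵢ) = (X + ρ)ʳ` forces `λᵢ = ρ`; one natural number separates -/

section Arithmetic

/-- **`∏ᵢ (X + λᵢ) = (X + ρ)^{#ι}` in `ℂ[X]` only if every `λᵢ = ρ`** (evaluate at `-λᵢ`). [folklore] -/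
theorem eq_of_prod_X_add_C_eq_pow {ι : Type*} [Fintype ι] {v : ι → ℂ} {ρ : ℂ}
    (h : ∏ i, (X + C (v i)) = (X + C ρ) ^ Fintype.card ι) (i : ι) : v i = ρ := by
  classical
  have h1 := congrArg (Polynomial.eval (-v i)) h
  rw [eval_prod, eval_pow, eval_add, eval_X, eval_C,
    Finset.prod_eq_zero (Finset.mem_univ i) (by rw [eval_add, eval_X, eval_C, neg_add_cancel])] at h1
  haveI : Nonempty ι := ⟨i⟩
  have hcard : Fintype.card ι ≠ 0 := Fintype.card_ne_zero
  have h2 : -v i + ρ = 0 := (pow_eq_zero_iff hcard).1 h1.symm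
  linear_combination -h2

/-- **A character identity on `ℕ` is a polynomial identity**: if `∏ᵢ (x + λᵢ) = (x + ρ)^{#ι}` for
every natural number `x`, then every `λᵢ = ρ` (the difference polynomial has infinitely many roots).
(The `Fin N`-indexed form is `eq_of_forall_prod_natCast_add_eq_pow` of
`WeilClassesFieldSplitSquareZetaEight`, whose `ζ₈`/Prym imports this file avoids.) [folklore] -/
theorem eq_of_forall_prod_natCast_add_eq_pow_card {ι : Type*} [Fintype ι] {v : ι → ℂ} {ρ : ℂ}
    (h : ∀ x : ℕ, ∏ i, ((x : ℂ) + v i) = ((x : ℂ) + ρ) ^ Fintype.card ι) (i : ι) : v i = ρ := by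
  classical
  refine eq_of_prod_X_add_C_eq_pow (sub_eq_zero.1 ?_) i
  apply Polynomial.eq_zero_of_infinite_isRoot
  refine Set.Infinite.mono ?_ (Set.infinite_range_of_injective Nat.cast_injective)
  rintro _ ⟨x, rfl⟩
  simp only [Set.mem_setOf_eq, IsRoot.def, eval_sub, eval_prod, eval_pow, eval_add, eval_X, eval_C,
    h x, sub_self]

/-- **One natural number separates all wedge characters from all Weil characters at once.** Given
finitely many "eigenvalues" `λⱼ`, `j : Fin N`, and a finite set `Z ⊂ ℂ`, there is `x₀ ∈ ℕ` such that
for every `r`-tuple `f` of indices and every `ρ ∈ Z`, `∏ᵢ (x₀ + λ_{f i}) = (x₀ + ρ)ʳ` only when all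
`λ_{f i} = ρ`: each of the finitely many polynomial differences `∏ᵢ (X + λ_{f i}) - (X + ρ)ʳ` that is
not identically zero has finitely many roots (the mechanism of `exists_nat_separating`, file
`WeilClassesRationalPlane`, for `e` eigenvalues instead of `2`). [folklore] -/
theorem exists_nat_separating_prod {N : ℕ} (lam : Fin N → ℂ) (Z : Finset ℂ) (r : ℕ) :
    ∃ x₀ : ℕ, ∀ (f : Fin r → Fin N), ∀ ρ ∈ Z,
      ∏ i, ((x₀ : ℂ) + lam (f i)) = ((x₀ : ℂ) + ρ) ^ r → ∀ i, lam (f i) = ρ := by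
  classical
  -- the bad pairs and the product of their (non-zero) difference polynomials
  let bad : Finset ((Fin r → Fin N) × ℂ) :=
    (Finset.univ ×ˢ Z).filter fun p => ¬ ∀ i, lam (p.1 i) = p.2
  let D : (Fin r → Fin N) × ℂ → ℂ[X] := fun p => ∏ i, (X + C (lam (p.1 i))) - (X + C p.2) ^ r
  have hD : ∀ p ∈ bad, D p ≠ 0 := by
    intro p hp hzero
    have hne : ¬ ∀ i, lam (p.1 i) = p.2 := (Finset.mem_filter.1 hp).2
    apply hne
    intro i
    have h' : ∏ i, (X + C (lam (p.1 i))) = (X + C p.2) ^ Fintype.card (Fin r) := by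
      rw [Fintype.card_fin]; exact sub_eq_zero.1 hzero
    exact eq_of_prod_X_add_C_eq_pow (v := fun i => lam (p.1 i)) h' i
  let Q : ℂ[X] := ∏ p ∈ bad, D p
  have hQ : Q ≠ 0 := Finset.prod_ne_zero_iff.2 hD
  obtain ⟨x₀, hx₀⟩ : ∃ x₀ : ℕ, Q.eval (x₀ : ℂ) ≠ 0 := by
    by_contra! hall
    apply hQ
    apply Polynomial.eq_zero_of_infinite_isRoot
    refine Set.Infinite.mono ?_ (Set.infinite_range_of_injective Nat.cast_injective)
    rintro _ ⟨x, rfl⟩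
    exact hall x
  refine ⟨x₀, fun f ρ hρ heq => ?_⟩
  by_contra hne
  have hmem : (f, ρ) ∈ bad := Finset.mem_filter.2 ⟨Finset.mem_product.2 ⟨Finset.mem_univ _, hρ⟩, hne⟩
  apply hx₀
  rw [eval_prod]
  refine Finset.prod_eq_zero hmem ?_
  simp only [D, eval_sub, eval_prod, eval_pow, eval_add, eval_X, eval_C, heq, sub_self]

end Arithmetic

/-! ### Endomorphisms act on `H¹` through the ring `End A`: `P(φ)^* = P(φ^*)` -/

section EndAction

variable {A : Motives.AbelianVariety ℂ}

/-- `(φⁿ)^* = (φ^*)ⁿ` on `H¹(A(ℂ); ℂ)`, powers in the ring `End A` (composition) and in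
`End_ℂ H¹`. [cite: LangeBirkenhake1992, §1.1 (p. 19)] -/
theorem hom_complexBetti_map_pow_one (φ : A ⟶ A) (n : ℕ) :
    (complexBetti.map (End.asHom (End.of φ ^ n)).hom.hom.hom 1).hom =
      (complexBetti.map φ.hom.hom.hom 1).hom ^ n := by
  induction n with
  | zero =>
    rw [pow_zero, pow_zero]
    change (complexBetti.map (𝟙 A.X) 1).hom = 1
    rw [complexBetti.map_id]
    rfl
  | succ n ih =>
    rw [pow_succ, pow_succ']
    change (complexBetti.map (φ.hom.hom.hom ≫ (End.asHom (End.of φ ^ n)).hom.hom.hom) 1).hom = _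
    rw [complexBetti.map_comp, ModuleCat.hom_comp, ih]
    rfl

/-- `(a T ⁿ)(φ)^* = a (φ^*)ⁿ` on `H¹` for a monomial `a Tⁿ ∈ ℤ[T]` (the integers of the ring `End A`
are the multiplications `a · 𝟙_A`, and `(a · f)^* = a · f^*` on `H¹`, `complexBetti_map_zsmul_one`).
[cite: LangeBirkenhake1992, §1.1 (p. 19)] -/
theorem hom_complexBetti_map_eval₂_monomial_one (φ : A ⟶ A) (n : ℕ) (a : ℤ) :
    (complexBetti.map (End.asHom (Polynomial.eval₂ (Int.castRingHom (CategoryTheory.End A))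
        (End.of φ) (monomial n a))).hom.hom.hom 1).hom =
      (a : ℂ) • (complexBetti.map φ.hom.hom.hom 1).hom ^ n := by
  rw [Polynomial.eval₂_monomial, eq_intCast, ← zsmul_eq_mul, ← hom_complexBetti_map_pow_one,
    Int.cast_smul_eq_zsmul]
  have h := congrArg ModuleCat.Hom.hom (complexBetti_map_zsmul_one a (End.asHom (End.of φ ^ n)))
  rw [ModuleCat.hom_zsmul] at h
  exact h

/-- **`P(φ)^* = P(φ^*)` on `H¹(A(ℂ); ℂ)`** for every `P ∈ ℤ[T]`: the action of `End A` on `H¹` is a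
homomorphism of rings (up to order), van Geemen 4.8 "using the maps `f^*`"; Lange–Birkenhake's
rational representation `ρ_r`. [cite: LangeBirkenhake1992, §1.1 (p. 19)] [cite: vanGeemen1994HodgeAV, 4.8] -/
theorem hom_complexBetti_map_eval₂_one (φ : A ⟶ A) (P : Polynomial ℤ) :
    (complexBetti.map (End.asHom (Polynomial.eval₂ (Int.castRingHom (CategoryTheory.End A))
        (End.of φ) P)).hom.hom.hom 1).hom =
      Polynomial.aeval (complexBetti.map φ.hom.hom.hom 1).hom (P.map (Int.castRingHom ℂ)) := by
  induction P using Polynomial.induction_on' with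
  | add p q hp hq =>
    rw [Polynomial.eval₂_add, Polynomial.map_add, map_add, ← hp, ← hq]
    have h := congrArg ModuleCat.Hom.hom (complexBetti_map_add_one
      (End.asHom (Polynomial.eval₂ (Int.castRingHom (CategoryTheory.End A)) (End.of φ) p))
      (End.asHom (Polynomial.eval₂ (Int.castRingHom (CategoryTheory.End A)) (End.of φ) q)))
    rw [ModuleCat.hom_add] at h
    exact h
  | monomial n a =>
    rw [Polynomial.map_monomial, Polynomial.aeval_monomial, hom_complexBetti_map_eval₂_monomial_one,
      eq_intCast, Algebra.algebraMap_eq_smul_one, smul_mul_assoc, one_mul]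

/-- Hence **`P(φ) = 0` in `End A` gives `P(φ^*) = 0` on `H¹(A(ℂ); ℂ)`** (hypothesis in the literal
shape of `MoonenZarhin1998_weilClasses_hodgeCriterion` / `Deligne1982.IsWeilTypeCM.eval₂_eq_zero`).
[cite: LangeBirkenhake1992, §1.1 (p. 19)] [cite: MoonenZarhin1998WeilClasses, §1] -/
theorem aeval_hom_complexBetti_map_one_eq_zero {φ : A ⟶ A} {P : Polynomial ℤ}
    (hφ : Polynomial.eval₂ (Int.castRingHom (CategoryTheory.End A)) (φ : CategoryTheory.End A) P = 0) :
    Polynomial.aeval (complexBetti.map φ.hom.hom.hom 1).hom (P.map (Int.castRingHom ℂ)) = 0 := by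
  have h0 : End.asHom (Polynomial.eval₂ (Int.castRingHom (CategoryTheory.End A)) (End.of φ) P) =
      (0 : A ⟶ A) := hφ
  rw [← hom_complexBetti_map_eval₂_one, h0, complexBetti_map_zero_one, ModuleCat.hom_zero]

end EndAction

/-! ### `P` over `ℚ` and `ℂ`: roots, and the field `K = ℚ[T]/(P)` -/

section Roots

/-- `P_ℚ(ρ) = P(ρ)` for `ρ ∈ ℂ` (`ℤ → ℚ → ℂ` is the integer cast). [folklore] -/
theorem aeval_map_castRingHom_rat (ρ : ℂ) (P : Polynomial ℤ) :
    aeval ρ (P.map (Int.castRingHom ℚ)) = Polynomial.eval₂ (Int.castRingHom ℂ) ρ P := by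
  rw [aeval_def, eval₂_map, RingHom.ext_int ((algebraMap ℚ ℂ).comp (Int.castRingHom ℚ)) (Int.castRingHom ℂ)]

/-- `P_ℂ = (P_ℚ)_ℂ`. [folklore] -/
theorem map_castRingHom_complex_eq (P : Polynomial ℤ) :
    P.map (Int.castRingHom ℂ) = (P.map (Int.castRingHom ℚ)).map (algebraMap ℚ ℂ) := by
  rw [Polynomial.map_map, RingHom.ext_int ((algebraMap ℚ ℂ).comp (Int.castRingHom ℚ)) (Int.castRingHom ℂ)]

/-- The finite set of complex roots of `P ≠ 0`, membership. [folklore] -/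
theorem mem_roots_toFinset_map_iff {P : Polynomial ℤ} (hP : P ≠ 0) (μ : ℂ) :
    μ ∈ (P.map (Int.castRingHom ℂ)).roots.toFinset ↔ Polynomial.eval₂ (Int.castRingHom ℂ) μ P = 0 := by
  classical
  have hPC : P.map (Int.castRingHom ℂ) ≠ 0 :=
    (Polynomial.map_ne_zero_iff (RingHom.injective_int (Int.castRingHom ℂ))).2 hP
  rw [Multiset.mem_toFinset, mem_roots hPC, IsRoot.def, Polynomial.eval_map]

/-- A ring homomorphism out of `K = ℚ[T]/(P)` sends the class of `T` to a complex root of `P`.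
[folklore] -/
theorem eval₂_ringHom_root_eq_zero (P : Polynomial ℤ)
    (ψ : AdjoinRoot (P.map (Int.castRingHom ℚ)) →+* ℂ) :
    Polynomial.eval₂ (Int.castRingHom ℂ) (ψ (AdjoinRoot.root (P.map (Int.castRingHom ℚ)))) P = 0 := by
  have h := congrArg ψ (AdjoinRoot.eval₂_root (P.map (Int.castRingHom ℚ)))
  rw [Polynomial.hom_eval₂, map_zero, eval₂_map,
    RingHom.ext_int ((ψ.comp (AdjoinRoot.of (P.map (Int.castRingHom ℚ)))).comp (Int.castRingHom ℚ))
      (Int.castRingHom ℂ)] at h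
  exact h

/-- A ring homomorphism `ψ : K = ℚ[T]/(P) → ℂ` sends `g ∈ K` to a root of `minpoly_ℚ g`. [folklore] -/
theorem aeval_ringHom_minpoly_eq_zero {P : Polynomial ℤ} (ψ : AdjoinRoot (P.map (Int.castRingHom ℚ)) →+* ℂ)
    (g : AdjoinRoot (P.map (Int.castRingHom ℚ))) : aeval (ψ g) (minpoly ℚ g) = 0 := by
  have h := congrArg ψ (minpoly.aeval ℚ g)
  rw [aeval_def, Polynomial.hom_eval₂, map_zero,
    RingHom.ext_rat (ψ.comp (algebraMap ℚ (AdjoinRoot (P.map (Int.castRingHom ℚ))))) (algebraMap ℚ ℂ),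
    ← aeval_def] at h
  exact h

/-- **The complex roots of `minpoly_ℚ ((x₀ + T)ʳ)`, `T` the class of `T` in `K = ℚ[T]/(P)`, versus
the numbers `(x₀ + ρ)ʳ` over the complex roots `ρ` of `P`.** (i) Every `(x₀ + ρ)ʳ` is a root: it is
the image of `(x₀ + T)ʳ` under `K → ℂ`, `T ↦ ρ` (`AdjoinRoot.lift`). [folklore] -/
theorem aeval_minpoly_pow_eq_zero (P : Polynomial ℤ) (x₀ r : ℕ) {ρ : ℂ}
    (hρ : Polynomial.eval₂ (Int.castRingHom ℂ) ρ P = 0) :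
    aeval (((x₀ : ℂ) + ρ) ^ r) (minpoly ℚ (((x₀ : AdjoinRoot (P.map (Int.castRingHom ℚ))) +
      AdjoinRoot.root (P.map (Int.castRingHom ℚ))) ^ r)) = 0 := by
  have hρ' : (P.map (Int.castRingHom ℚ)).eval₂ (algebraMap ℚ ℂ) ρ = 0 := by
    rw [← aeval_def, aeval_map_castRingHom_rat, hρ]
  let ψ : AdjoinRoot (P.map (Int.castRingHom ℚ)) →+* ℂ := AdjoinRoot.lift (algebraMap ℚ ℂ) ρ hρ'
  have hψ : ψ (((x₀ : AdjoinRoot (P.map (Int.castRingHom ℚ))) + AdjoinRoot.root _) ^ r) =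
      ((x₀ : ℂ) + ρ) ^ r := by
    rw [map_pow, map_add, map_natCast, AdjoinRoot.lift_root]
  rw [← hψ]
  exact aeval_ringHom_minpoly_eq_zero ψ _

/-- (ii) For `P` irreducible over `ℚ` (so that `K` is a number field), every complex root of
`minpoly_ℚ ((x₀ + T)ʳ)` is `(x₀ + ρ)ʳ` for a complex root `ρ` of `P`: the roots of a minimal polynomial
are the images under the `[K:ℚ]` embeddings `K → ℂ` (Mathlib
`Algebra.IsAlgebraic.range_eval_eq_rootSet_minpoly`). [folklore] -/
theorem exists_root_of_aeval_minpoly_pow_eq_zero {P : Polynomial ℤ}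
    [Fact (Irreducible (P.map (Int.castRingHom ℚ)))] (x₀ r : ℕ) {z : ℂ}
    (hz : aeval z (minpoly ℚ (((x₀ : AdjoinRoot (P.map (Int.castRingHom ℚ))) +
        AdjoinRoot.root (P.map (Int.castRingHom ℚ))) ^ r)) = 0) :
    ∃ ρ : ℂ, Polynomial.eval₂ (Int.castRingHom ℂ) ρ P = 0 ∧ z = ((x₀ : ℂ) + ρ) ^ r := by
  have hPirr : Irreducible (P.map (Int.castRingHom ℚ)) := Fact.out
  haveI : FiniteDimensional ℚ (AdjoinRoot (P.map (Int.castRingHom ℚ))) :=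
    (AdjoinRoot.powerBasis hPirr.ne_zero).finite
  set g : AdjoinRoot (P.map (Int.castRingHom ℚ)) :=
    ((x₀ : AdjoinRoot (P.map (Int.castRingHom ℚ))) + AdjoinRoot.root (P.map (Int.castRingHom ℚ))) ^ r
    with hg
  have hz' : z ∈ (minpoly ℚ g).rootSet ℂ :=
    Polynomial.mem_rootSet.2 ⟨minpoly.ne_zero (Algebra.IsIntegral.isIntegral g), hz⟩
  rw [← Algebra.IsAlgebraic.range_eval_eq_rootSet_minpoly ℂ g] at hz'
  obtain ⟨ψ, hψ⟩ := hz'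
  beta_reduce at hψ
  refine ⟨ψ (AdjoinRoot.root _), eval₂_ringHom_root_eq_zero P ψ.toRingHom, ?_⟩
  rw [← hψ, hg, map_pow, map_add, map_natCast]

end Roots

/-! ### An eigenbasis of `H¹(A(ℂ); ℂ)` for `φ^*` when `P(φ) = 0`, `P` irreducible -/

section Eigenbasis

variable {A : Motives.AbelianVariety ℂ}

/-- **`H¹(A(ℂ); ℂ) = ⊕_{P(ρ)=0} V_ρ` has an eigenbasis** when `P(φ) = 0` in `End A` for a `P ∈ ℤ[T]`
irreducible over `ℚ`: `P` is separable, so `φ^*|H¹` is semisimple (Mathlib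
`Module.End.isSemisimple_of_squarefree_aeval_eq_zero`, `IsSemisimple.iSup_eigenspace_eq_top`), and
the eigenvalues are roots of `P` (`Module.End.aeval_apply_of_hasEigenvector`); a basis adapted to
the (independent, spanning) eigenspaces is `DirectSum.IsInternal.collectedBasis` — Moonen–Zarhin's
"`V_ℂ = ⊕_{σ ∈ Σ_F} V_{ℂ,σ}`". [cite: MoonenZarhin1998WeilClasses, §1] -/
theorem exists_eigenbasis_complexBetti_one {φ : A ⟶ A} {P : Polynomial ℤ}
    (hPirr : Irreducible (P.map (Int.castRingHom ℚ)))
    (hφ : Polynomial.eval₂ (Int.castRingHom (CategoryTheory.End A)) (φ : CategoryTheory.End A) P = 0) :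
    ∃ (N : ℕ) (b : Module.Basis (Fin N) ℂ (complexBetti A.X 1)) (lam : Fin N → ℂ),
      (∀ i, Polynomial.eval₂ (Int.castRingHom ℂ) (lam i) P = 0) ∧
      ∀ i, b i ∈ Module.End.eigenspace (complexBetti.map φ.hom.hom.hom 1).hom (lam i) := by
  classical
  haveI := finite_complexBetti_abelianVariety A 1
  set F : Module.End ℂ (complexBetti A.X 1) := (complexBetti.map φ.hom.hom.hom 1).hom with hFdef
  have hP0 : P ≠ 0 := fun h => hPirr.ne_zero (by rw [h, Polynomial.map_zero])
  have hsepC : (P.map (Int.castRingHom ℂ)).Separable := by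
    rw [map_castRingHom_complex_eq]; exact hPirr.separable.map
  have hF : aeval F (P.map (Int.castRingHom ℂ)) = 0 := aeval_hom_complexBetti_map_one_eq_zero hφ
  have hss : F.IsSemisimple :=
    Module.End.isSemisimple_of_squarefree_aeval_eq_zero hsepC.squarefree hF
  have htop : ⨆ μ, F.eigenspace μ = ⊤ := hss.iSup_eigenspace_eq_top
  -- eigenvalues are roots of `P`
  have hroot : ∀ μ, F.eigenspace μ ≠ ⊥ → Polynomial.eval₂ (Int.castRingHom ℂ) μ P = 0 := by
    intro μ hμ
    obtain ⟨v, hv, hv0⟩ := (Submodule.ne_bot_iff _).1 hμ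
    have h := Module.End.aeval_apply_of_hasEigenvector (f := F) (p := P.map (Int.castRingHom ℂ))
      (Module.End.hasEigenvector_iff.2 ⟨hv, hv0⟩)
    rw [hF, LinearMap.zero_apply, Polynomial.eval_map] at h
    exact (smul_eq_zero.1 h.symm).resolve_right hv0
  -- the internal direct sum over the finite set of roots
  let Z : Finset ℂ := (P.map (Int.castRingHom ℂ)).roots.toFinset
  let V : Z → Submodule ℂ (complexBetti A.X 1) := fun ρ => F.eigenspace (ρ : ℂ)
  have hind : iSupIndep V := (Module.End.eigenspaces_iSupIndep F).comp Subtype.val_injective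
  have hsup : iSup V = ⊤ := by
    refine le_antisymm le_top ?_
    rw [← htop]
    refine iSup_le fun μ => ?_
    by_cases hμ : F.eigenspace μ = ⊥
    · rw [hμ]; exact bot_le
    · exact le_iSup V ⟨μ, (mem_roots_toFinset_map_iff hP0 μ).2 (hroot μ hμ)⟩
  have hint : DirectSum.IsInternal V := DirectSum.isInternal_submodule_of_iSupIndep_of_iSup_eq_top hind hsup
  let bS := hint.collectedBasis fun ρ => Module.finBasis ℂ (V ρ)
  let e := Fintype.equivFin (Σ ρ : Z, Fin (Module.finrank ℂ (V ρ)))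
  refine ⟨_, bS.reindex e, fun i => ((e.symm i).1 : ℂ),
    fun i => (mem_roots_toFinset_map_iff hP0 _).1 (e.symm i).1.2, fun i => ?_⟩
  rw [Module.Basis.reindex_apply]
  exact hint.collectedBasis_mem _ _

end Eigenbasis

/-! ### The theorem -/

section WeilField

variable {A : Motives.AbelianVariety ℂ}

/-- Powers of a pull-back preserve rational classes. [cite: HatcherAT2002, §3.1 p. 198] -/
theorem isRationalClass_pow_hom_complexBetti_map {X : Motives.SchemeOver ℂ} (f : X ⟶ X) {k : ℕ}
    (j : ℕ) {c : complexBetti X k} (hc : IsRationalClass c) :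
    IsRationalClass (((complexBetti.map f k).hom ^ j) c) := by
  induction j generalizing c with
  | zero => rwa [pow_zero, Module.End.one_apply]
  | succ j ih => rw [pow_succ, Module.End.mul_apply]; exact ih (isRationalClass_complexBetti_map f hc)

/-- A pull-back evaluated in a RATIONAL polynomial preserves rational classes.
[cite: HatcherAT2002, §3.1 p. 198] -/
theorem isRationalClass_aeval_hom_complexBetti_map {X : Motives.SchemeOver ℂ} (f : X ⟶ X) {k : ℕ}
    (M : Polynomial ℚ) {c : complexBetti X k} (hc : IsRationalClass c) :
    IsRationalClass (aeval (complexBetti.map f k).hom (M.map (algebraMap ℚ ℂ)) c) := by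
  rw [Polynomial.aeval_eq_sum_range, LinearMap.sum_apply]
  have h : ∀ i ∈ Finset.range ((M.map (algebraMap ℚ ℂ)).natDegree + 1),
      ((M.map (algebraMap ℚ ℂ)).coeff i • (complexBetti.map f k).hom ^ i) c =
        ((M.coeff i : ℚ) : ℂ) • (((complexBetti.map f k).hom ^ i) c) := by
    intro i _
    rw [LinearMap.smul_apply, Polynomial.coeff_map, eq_ratCast]
  rw [Finset.sum_congr rfl h]
  exact IsRationalClass.sum_smul _ (fun j => isRationalClass_pow_hom_complexBetti_map f j hc) _

/-- **`W_F ⊗ ℂ` is spanned by its rational classes** (Moonen–Zarhin §1: `W_F := ⋀^r_F H¹(X, ℚ) ⊂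
H^r(X, ℚ)`, `W_F ⊗ ℂ = ⊕_σ ⋀^r V_{ℂ,σ}`; Deligne–Milne (4.4)), on the tree's spectral carrier: for a
complex abelian variety `A`, `φ : A ⟶ A` and `P ∈ ℤ[T]` irreducible over `ℚ` with `P(φ) = 0` in
`End A` — i.e. `F = ℚ[φ] ≅ ℚ[T]/(P)` is a subfield of `End⁰(A)` — and every degree `r`,
`weilClassesField A φ P r = ⨆_{P(ρ)=0} ⋀ʳ V_ρ` is the complex span of its RATIONAL classes. Proof in
the module docstring (eigenbasis, wedge basis, a separating test endomorphism `x₀·𝟙 + φ`, the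
rational operator `minpoly_ℚ((x₀ + T)ʳ)((x₀·𝟙 + φ)^*)` whose kernel is `W_F ⊗ ℂ`, and
`ker_eq_span_isRationalClass`). The quadratic case is `weilClassesOf_eq_span_isRationalClass`.
[cite: MoonenZarhin1998WeilClasses, §1 (definition of W_F, Lemma (1), W_F ⊗ ℂ = ⊕_σ ⋀^r V_{ℂ,σ})] [cite: Deligne1982HodgeCycles, §4 (4.4)] -/
theorem weilClassesField_eq_span_isRationalClass {φ : A ⟶ A} {P : Polynomial ℤ}
    (hPirr : Irreducible (P.map (Int.castRingHom ℚ)))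
    (hφ : Polynomial.eval₂ (Int.castRingHom (CategoryTheory.End A)) (φ : CategoryTheory.End A) P = 0)
    (r : ℕ) :
    weilClassesField A φ P r = Submodule.span ℂ
      {c : complexBetti A.X r | IsRationalClass c ∧ c ∈ weilClassesField A φ P r} := by
  classical
  obtain ⟨N, b, lam, hlamP, hb_mem⟩ := exists_eigenbasis_complexBetti_one hPirr hφ
  have hΛ := Motives.AbelianVariety.hasExteriorCohomologyH1_complexPoints A
  have hX : IsSmoothProjective A.dim A.X := Motives.AbelianVariety.isSmoothProjective_holds (A := A)
  have hP0 : P ≠ 0 := fun h => hPirr.ne_zero (by rw [h, Polynomial.map_zero])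
  -- the finite set of complex roots of `P`
  let Z : Finset ℂ := (P.map (Int.castRingHom ℂ)).roots.toFinset
  have hZ : ∀ μ, μ ∈ Z ↔ Polynomial.eval₂ (Int.castRingHom ℂ) μ P = 0 := mem_roots_toFinset_map_iff hP0
  -- the wedge basis of `Hʳ = ⋀ʳ H¹` and the action of the test endomorphisms on it
  let Bw : Module.Basis (Set.powersetCard (Fin N) r) ℂ (complexBetti A.X r) :=
    (b.exteriorPower r).map (hΛ.equiv r)
  have hBw : ∀ S, Bw S = cupPowOne ℂ (Motives.ComplexPoints A.X) r
      (b ∘ (Set.powersetCard.ofFinEmbEquiv.symm S)) := by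
    intro S
    change hΛ.equiv r ((b.exteriorPower r) S) = _
    rw [exteriorPower.basis_apply, HasExteriorCohomologyH1.equiv_apply, exteriorPower.ιMulti_family,
      wedgeToCup_ιMulti]
  have hact : ∀ (pr : ℕ × ℕ) (S : Set.powersetCard (Fin N) r),
      (complexBetti.map (pr.1 • 𝟙 A + pr.2 • φ).hom.hom.hom r).hom (Bw S) =
        (∏ i : Fin r, ((pr.1 : ℂ) + (pr.2 : ℂ) * lam (Set.powersetCard.ofFinEmbEquiv.symm S i))) •
          Bw S := by
    rintro ⟨x, y⟩ S
    rw [hBw]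
    change singularCohomology.map ℂ ℂ
      (Motives.AlgPoints.mapContinuous (L := ℂ) (x • 𝟙 A + y • φ).hom.hom.hom) r
        (cupPowOne ℂ _ r _) = _
    rw [map_cupPowOne]
    have e : (fun i => singularCohomology.map ℂ ℂ
        (Motives.AlgPoints.mapContinuous (L := ℂ) (x • 𝟙 A + y • φ).hom.hom.hom) 1
          ((b ∘ (Set.powersetCard.ofFinEmbEquiv.symm S)) i)) =
        fun i => ((x : ℂ) + (y : ℂ) * lam (Set.powersetCard.ofFinEmbEquiv.symm S i)) •
          (b ∘ (Set.powersetCard.ofFinEmbEquiv.symm S)) i := by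
      funext i
      exact complexBetti_map_nsmul_id_add_nsmul_one_of_mem_eigenspace (hb_mem _) x y
    rw [e, MultilinearMap.map_smul_univ]
  -- the summands `⋀ʳ V_ρ` in the wedge basis: all `r` eigenvalues equal to `ρ`
  let good : ℂ → Set (Set.powersetCard (Fin N) r) :=
    fun ρ => {S | ∀ i : Fin r, lam (Set.powersetCard.ofFinEmbEquiv.symm S i) = ρ}
  have hgood_prod : ∀ ρ, ∀ S ∈ good ρ, ∀ x y : ℂ,
      (∏ i : Fin r, (x + y * lam (Set.powersetCard.ofFinEmbEquiv.symm S i))) = (x + y * ρ) ^ r := by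
    intro ρ S hS x y
    rw [Finset.prod_congr rfl (fun i _ => by rw [hS i]), Finset.prod_const, Finset.card_univ,
      Fintype.card_fin]
  have hχ : ∀ ρ (S : Set.powersetCard (Fin N) r),
      ((fun pr : ℕ × ℕ => ∏ i : Fin r,
          ((pr.1 : ℂ) + (pr.2 : ℂ) * lam (Set.powersetCard.ofFinEmbEquiv.symm S i))) =
        fun pr : ℕ × ℕ => ((pr.1 : ℂ) + (pr.2 : ℂ) * ρ) ^ r) ↔ S ∈ good ρ := by
    intro ρ S
    constructor
    · intro h i
      refine eq_of_forall_prod_natCast_add_eq_pow_card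
        (v := fun i : Fin r => lam (Set.powersetCard.ofFinEmbEquiv.symm S i)) (ρ := ρ) (fun x => ?_) i
      have hx := congrFun h (x, 1)
      simp only [Nat.cast_one, one_mul] at hx
      rw [Fintype.card_fin]
      exact hx
    · intro hS
      funext pr
      exact hgood_prod ρ S hS _ _
  have hE : ∀ ρ, pullbackEigenclasses A φ r (fun x y => ((x : ℂ) + (y : ℂ) * ρ) ^ r) =
      Submodule.span ℂ (Bw '' good ρ) := by
    intro ρ
    ext c
    rw [mem_pullbackEigenclasses_iff]
    have h2 := forall_apply_eq_smul_iff_mem_span_image (P := ℕ × ℕ) Bw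
      (fun pr => (complexBetti.map (pr.1 • 𝟙 A + pr.2 • φ).hom.hom.hom r).hom)
      (fun S pr => ∏ i : Fin r,
        ((pr.1 : ℂ) + (pr.2 : ℂ) * lam (Set.powersetCard.ofFinEmbEquiv.symm S i)))
      hact (fun pr => ((pr.1 : ℂ) + (pr.2 : ℂ) * ρ) ^ r) c
    have hs2 : {S : Set.powersetCard (Fin N) r |
        (fun pr : ℕ × ℕ => ∏ i : Fin r,
          ((pr.1 : ℂ) + (pr.2 : ℂ) * lam (Set.powersetCard.ofFinEmbEquiv.symm S i))) =
          fun pr : ℕ × ℕ => ((pr.1 : ℂ) + (pr.2 : ℂ) * ρ) ^ r} = good ρ := by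
      ext S
      exact hχ ρ S
    rw [hs2] at h2
    constructor
    · intro hc
      exact h2.1 fun pr => hc pr.1 pr.2
    · intro hc x y
      exact (h2.2 hc) (x, y)
  -- a separating test endomorphism `x₀·𝟙 + φ`
  obtain ⟨x₀, hsep⟩ := exists_nat_separating_prod lam Z r
  set T₀ : Module.End ℂ (complexBetti A.X r) :=
    (complexBetti.map (x₀ • 𝟙 A + 1 • φ).hom.hom.hom r).hom with hT₀def
  have hT₀S : ∀ S : Set.powersetCard (Fin N) r,
      T₀ (Bw S) = (∏ i : Fin r, ((x₀ : ℂ) + lam (Set.powersetCard.ofFinEmbEquiv.symm S i))) • Bw S := by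
    intro S
    have h := hact (x₀, 1) S
    simp only [Nat.cast_one, one_mul] at h
    exact h
  -- the rational polynomial `M = minpoly_ℚ ((x₀ + T)ʳ)` over `K = ℚ[T]/(P)` and the operator `M(T₀)`
  haveI : Fact (Irreducible (P.map (Int.castRingHom ℚ))) := ⟨hPirr⟩
  let M : Polynomial ℚ := minpoly ℚ (((x₀ : AdjoinRoot (P.map (Int.castRingHom ℚ))) +
    AdjoinRoot.root (P.map (Int.castRingHom ℚ))) ^ r)
  have hMroot : ∀ ρ, Polynomial.eval₂ (Int.castRingHom ℂ) ρ P = 0 →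
      (M.map (algebraMap ℚ ℂ)).eval (((x₀ : ℂ) + ρ) ^ r) = 0 := by
    intro ρ hρ
    rw [Polynomial.eval_map, ← aeval_def]
    exact aeval_minpoly_pow_eq_zero P x₀ r hρ
  have hMroots : ∀ z : ℂ, (M.map (algebraMap ℚ ℂ)).eval z = 0 →
      ∃ ρ : ℂ, Polynomial.eval₂ (Int.castRingHom ℂ) ρ P = 0 ∧ z = ((x₀ : ℂ) + ρ) ^ r := by
    intro z hz
    rw [Polynomial.eval_map, ← aeval_def] at hz
    exact exists_root_of_aeval_minpoly_pow_eq_zero x₀ r hz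
  set Op : Module.End ℂ (complexBetti A.X r) := aeval T₀ (M.map (algebraMap ℚ ℂ)) with hOpdef
  have hOpS : ∀ S : Set.powersetCard (Fin N) r, Op (Bw S) =
      (M.map (algebraMap ℚ ℂ)).eval
        (∏ i : Fin r, ((x₀ : ℂ) + lam (Set.powersetCard.ofFinEmbEquiv.symm S i))) • Bw S := by
    intro S
    exact Module.End.aeval_apply_of_hasEigenvector
      (Module.End.hasEigenvector_iff.2 ⟨Module.End.mem_eigenspace_iff.2 (hT₀S S), Bw.ne_zero S⟩)
  have hOp_rat : ∀ c : complexBetti A.X r, IsRationalClass c → IsRationalClass (Op c) :=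
    fun c hc => isRationalClass_aeval_hom_complexBetti_map _ M hc
  -- `ker M(T₀) = W_F ⊗ ℂ`
  have hker : LinearMap.ker Op = weilClassesField A φ P r := by
    refine le_antisymm ?_ ?_
    · intro v hv
      rw [LinearMap.mem_ker] at hv
      have h1 := forall_apply_eq_smul_iff_mem_span_image (P := Unit) Bw (fun _ => Op)
        (fun S _ => (M.map (algebraMap ℚ ℂ)).eval
          (∏ i : Fin r, ((x₀ : ℂ) + lam (Set.powersetCard.ofFinEmbEquiv.symm S i))))
        (fun _ S => hOpS S) (fun _ => (0 : ℂ)) v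
      have hv' := h1.1 (fun _ => by rw [hv, zero_smul])
      refine Submodule.span_le.2 ?_ hv'
      rintro _ ⟨S, hS, rfl⟩
      have hS0 : (M.map (algebraMap ℚ ℂ)).eval
          (∏ i : Fin r, ((x₀ : ℂ) + lam (Set.powersetCard.ofFinEmbEquiv.symm S i))) = 0 :=
        congrFun hS ()
      obtain ⟨ρ, hρ, hzρ⟩ := hMroots _ hS0
      have hgoodS : S ∈ good ρ := hsep _ ρ ((hZ ρ).2 hρ) hzρ
      have hmem : Bw S ∈ pullbackEigenclasses A φ r (fun x y => ((x : ℂ) + (y : ℂ) * ρ) ^ r) := by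
        rw [hE ρ]
        exact Submodule.subset_span ⟨S, hgoodS, rfl⟩
      exact pullbackEigenclasses_le_weilClassesField hρ hmem
    · refine iSup₂_le fun ρ hρ => ?_
      intro c hc
      rw [LinearMap.mem_ker]
      have hcT : T₀ c = (((x₀ : ℂ) + ρ) ^ r) • c := by
        have h := (mem_pullbackEigenclasses_iff.1 hc) x₀ 1
        simp only [Nat.cast_one, one_mul] at h
        exact h
      by_cases hc0 : c = 0
      · rw [hc0, map_zero]
      · rw [hOpdef, Module.End.aeval_apply_of_hasEigenvector
          (Module.End.hasEigenvector_iff.2 ⟨Module.End.mem_eigenspace_iff.2 hcT, hc0⟩), hMroot ρ hρ,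
          zero_smul]
  -- kernels of rational operators are spanned by rational classes
  have hspan := ker_eq_span_isRationalClass hX Op hOp_rat
  rw [hker] at hspan
  have hset : {x : complexBetti A.X r | IsRationalClass x ∧ Op x = 0} =
      {c : complexBetti A.X r | IsRationalClass c ∧ c ∈ weilClassesField A φ P r} := by
    ext x
    simp only [Set.mem_setOf_eq, ← hker, LinearMap.mem_ker]
  rw [hset] at hspan
  exact hspan

/-- **The non-trivial inclusion, in the binder shape used Summit-side** (`{c | c ∈ W ∧ c rational}`,
the descent input of the ring-2 row T6-CM): under Moonen–Zarhin's hypotheses (`P` irreducible over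
`ℚ`, `P(φ) = 0`), `weilClassesField A φ P r ≤ span_ℂ {c | c ∈ weilClassesField A φ P r ∧ IsRationalClass c}`.
[cite: MoonenZarhin1998WeilClasses, §1 (definition of W_F, Lemma (1))] -/
theorem weilClassesField_le_span_isRationalClass {φ : A ⟶ A} {P : Polynomial ℤ}
    (hPirr : Irreducible (P.map (Int.castRingHom ℚ)))
    (hφ : Polynomial.eval₂ (Int.castRingHom (CategoryTheory.End A)) (φ : CategoryTheory.End A) P = 0)
    (r : ℕ) :
    weilClassesField A φ P r ≤
      Submodule.span ℂ {c | c ∈ weilClassesField A φ P r ∧ IsRationalClass c} := by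
  have hset : {c | c ∈ weilClassesField A φ P r ∧ IsRationalClass c} =
      {c : complexBetti A.X r | IsRationalClass c ∧ c ∈ weilClassesField A φ P r} := by
    ext c; exact and_comm
  rw [hset, ← weilClassesField_eq_span_isRationalClass hPirr hφ r]

/-- **Corollary: a complex-subspace statement from its rational points.** Under the same
hypotheses, if every RATIONAL class of `W_F ⊗ ℂ` in degree `r` lies in a complex subspace `G` (e.g.
`G = algebraicClasses A.X (r/2)`: "the Weil classes are algebraic", class by class), then
`W_F ⊗ ℂ ≤ G`. [cite: MoonenZarhin1998WeilClasses, §1 (definition of W_F, Lemma (1))] -/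
theorem weilClassesField_le_of_forall_isRationalClass {φ : A ⟶ A} {P : Polynomial ℤ}
    (hPirr : Irreducible (P.map (Int.castRingHom ℚ)))
    (hφ : Polynomial.eval₂ (Int.castRingHom (CategoryTheory.End A)) (φ : CategoryTheory.End A) P = 0)
    {r : ℕ} {G : Submodule ℂ (complexBetti A.X r)}
    (hG : ∀ c ∈ weilClassesField A φ P r, IsRationalClass c → c ∈ G) :
    weilClassesField A φ P r ≤ G := by
  rw [weilClassesField_eq_span_isRationalClass hPirr hφ r, Submodule.span_le]
  rintro c ⟨hcQ, hcW⟩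
  exact hG c hcW hcQ

end WeilField

end HodgeTheory

end Literature.AlgebraicGeometry.HodgeTheory
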